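import Literature.IUT.LogThetaLattice.PacketLogVolumeBridge
import Literature.IUT.LogThetaLattice.TensorPackets
import Literature.IUT.LogVolume.HaarTransport
import HarnessLib

/-!
# [IUTchIII] Proposition 3.9 — SUB-DAG junction statements (W6-S14), with the packet-level instance of
# (ii) "(Mono-analytic Compatibility)" PROVED at the Haar model (abc-iut cell, layer L6)

S. Mochizuki, *Inter-universal Teichmüller theory III*, kurims manuscript (May 2020), §3, Proposition 3.9,
pp. 115–118 [claim: Mochizuki2012, status: disputed]. Printed proof (p. 118): "The various assertions of
Proposition 3.9 follow immediately from the definitions and the references quoted in the statements of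
these assertions." The SUB-DAG of the node (D-0068 (1); `plan/L6/SUBDAG-IUTchIII-Prop-39.md`, seat
abc-iut-w5-d178, L6-lead SUBDAG-WANTED (L6) v1 row W6-S14) is therefore a census of JUNCTIONS between
the quoted inputs and the typed statement of record, abc-iut-L6-t4's `PacketLogVolumes.lean` (p404053):
(i) REAL `packetLogVolume` / `processionNormalized` (+ proved clauses), (ii) the predicate
`Prop39ii_monoAnalyticCompat poly μD μF := ∀ e ∈ poly, ∀ S, μD S = μF (e '' S)` over an ABSTRACT
poly-isomorphism, (iii) REAL `GlobalRegion` / `globalLogVolume` + `Prop39iii_invariance` /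
`Prop39iii_degree`, (iv) `Prop39iv_a` / `Prop39iv_b` — all other rows point at landed decls (see the .md).

The ONE junction the census found untyped is row Prop-39.ii.r13: (ii) is quoted "relative to the natural
poly-isomorphisms of Proposition 3.2, (i)", and Proposition 3.2 (i) IS typed (abc-iut-L6-t4
`TensorPackets.lean`, p403825: a family of summand isomorphisms `log(^α𝒟^⊢_v) ≅ log(^α𝓕_v)` induces
`MPacket1.compat α e : log(^α𝒟^⊢_{v_ℚ}) ≃ log(^α𝓕_{v_ℚ})` on 1-tensor packets, `MPacketN.compat` on `n`-tensor
packets, `MPacketAt.compat`, and the poly-version `MPacketN.polyCompat`), but no decl states (ii) AT these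
packet isomorphisms — the landed discharges (`PacketLogVolumesProofs2/3`, abc-iut-L6-d3) work with one
abstract container or with factorwise automorphisms of ONE family of summands. This file supplies:

* the junction STATEMENTS `Prop39ii_atPacket1`, `Prop39ii_atPacketN`, `Prop39ii_atPacketAt` := abc-iut-L6-t4's
  `Prop39ii_monoAnalyticCompat` instantiated at the poly-isomorphisms of Proposition 3.2 (i) on 1-packets /
  `n`-packets / the `(A,α)`-submodules (the log-volumes on the two sides stay parameters: the tensor
  packets of `TensorPackets.lean` are bare `𝕜`-modules, print's "ind-topological" structure is not
  modelled there), with their unfoldings `…_iff`;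
* the 1-PACKET junction PROVED at the Haar model ("the direct sum decompositions of Proposition 3.1, (i)",
  p. 115): for summands that are locally compact second-countable abelian groups with integral structures
  `Λ^D_v` (mono-analytic log-shell lattices) and `Λ^F_v` (holomorphic ones) and a poly-isomorphism whose
  members are families of bicontinuous additive isomorphisms `e_v` with `e_v(Λ^D_v) = Λ^F_v` — exactly the
  shape `MPacket1.compat` = `x ↦ (v ↦ e_v (x v))` (`coe_MPacket1_compat`) — (a) the product Haar
  log-volume (campaign-S `IntegralStructure.pi`, [IUTchIII] Rmk. 3.1.1 (iii)) satisfies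
  `Prop39ii_monoAnalyticCompat` on ALL regions (`prop39ii_monoAnalyticCompat_piSummands`), and (b) the
  PRINTED packet-normalised (weighted, Rmk. 3.1.1 (ii)) log-volume `packetLogVolume` of (i) is compatible
  on every direct-product region (`packetLogVolume_image_piSummands`), whatever the weights — both by
  campaign-S Haar transport `IntegralStructure.logVolume_image_equiv` (abc-iut-c312-d1, p405779).

HONEST SCOPE: theorems of Haar measure in the typers' vocabulary. NOT instantiated here: (1) the `n`-tensor
packet (`|A| ≥ 2`) — abc-iut-L6-t4's `PacketN`/`MPacketN` are bare `PiTensorProduct`s without topology,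
whereas the REAL one-place tensor packet with its module topology and intrinsic normalised Haar log-volume
is campaign-S's `Literature.IUT.LogVolume.PacketAlgebra` / `tensorLogVolume` (`TensorPacketHaar.lean`,
abc-iut-S7) with the (Ind1) factor-permutation transport `permAlgEquiv` / `image_normalizedPacket_perm`
(`TensorPacketTransport.lean`) and the decomposition bridge `packetLogVolume_eq_tensorLogVolume`
(`TensorPacketBridge.lean`) — tying `MPacketN.compat` to that family is the .md's residual row R-iii-tensor;
(2) the strip-level poly-isomorphism of Prop. 3.2 (i) on actual `𝒟^⊢`-prime-strips (abc-iut-L6-t3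
`BiCoricData.monoHolAt` over `StripFrame`, no Haar datum) — residual row R-ii-strip. Nothing here asserts a
disputed claim or takes a side on [IUTchIII] Cor. 3.12; typed ≠ endorsed.
-/

noncomputable section

namespace Literature.IUT.LogThetaLattice

open Literature.IUT.LogVolume Literature.IUT.LogVolume.IntegralStructure MeasureTheory Set

universe u v v' w u₁ u₂

/-! ### The junction statements: Prop. 3.9 (ii) AT the poly-isomorphisms of Prop. 3.2 (i) -/

section Junction

variable (𝕜 : Type u) [Field 𝕜]
variable {A : Type v} {Vfib : Type v'}
variable (D : A → Vfib → Type w) [∀ α v, AddCommGroup (D α v)] [∀ α v, Module 𝕜 (D α v)]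
variable (L : A → Vfib → Type w) [∀ α v, CommRing (L α v)] [∀ α v, Algebra 𝕜 (L α v)]

/-- **[IUTchIII] Prop. 3.9 (ii) at the 1-tensor packets of Prop. 3.2 (i)** (junction row Prop-39.ii.r13):
"log-volumes `μ^log_{α,v_ℚ} : 𝕄(𝓘^ℚ(^α𝒟^⊢_{v_ℚ})) → ℝ` … which are compatible with the log-volumes obtained in
(i), relative to the natural poly-isomorphisms of Proposition 3.2, (i)" (p. 116) — abc-iut-L6-t4's
`Prop39ii_monoAnalyticCompat` for the poly-isomorphism `{MPacket1.compat α (e α) | e ∈ P}` induced on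
`log(^α𝒟^⊢_{v_ℚ}) = ⊕_v log(^α𝒟^⊢_v)` by a poly-isomorphism `P` of families of summand isomorphisms.
[claim: Mochizuki2012, status: disputed] -/
def Prop39ii_atPacket1 (α : A) (P : Set (∀ α v, D α v ≃ₗ[𝕜] L α v))
    (μD : Set (MPacket1 D α) → ℝ) (μF : Set (Packet1 L α) → ℝ) : Prop :=
  Prop39ii_monoAnalyticCompat ((fun e => (MPacket1.compat α (e α)).toEquiv) '' P) μD μF

/-- **[IUTchIII] Prop. 3.9 (ii) at the `n`-tensor packets of Prop. 3.2 (i)** (row Prop-39.ii.r13):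
`Prop39ii_monoAnalyticCompat` for the poly-isomorphism `MPacketN.polyCompat P` on
`log(^A𝒟^⊢_{v_ℚ}) = ⊗_α log(^α𝒟^⊢_{v_ℚ})` ("`μ^log_{A,v_ℚ} : 𝕄(𝓘^ℚ(^A𝒟^⊢_{v_ℚ})) → ℝ`", p. 116).
[claim: Mochizuki2012, status: disputed] -/
def Prop39ii_atPacketN (P : Set (∀ α v, D α v ≃ₗ[𝕜] L α v))
    (μD : Set (MPacketN 𝕜 D) → ℝ) (μF : Set (PacketN 𝕜 L) → ℝ) : Prop :=
  Prop39ii_monoAnalyticCompat ((fun f => f.toEquiv) '' MPacketN.polyCompat P) μD μF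

/-- **[IUTchIII] Prop. 3.9 (ii) at the submodules `log(^{A,α}𝒟^⊢_v)` of Prop. 3.2 (i)** (row
Prop-39.ii.r13): `Prop39ii_monoAnalyticCompat` for the poly-isomorphism `{MPacketAt.compat e α v | e ∈ P}`
("`μ^log_{A,α,v} : 𝕄(𝓘^ℚ(^{A,α}𝒟^⊢_v)) → ℝ`", p. 116). [claim: Mochizuki2012, status: disputed] -/
def Prop39ii_atPacketAt (α : A) (v : Vfib) (P : Set (∀ α v, D α v ≃ₗ[𝕜] L α v))
    (μD : Set (MPacketAt 𝕜 D α v) → ℝ) (μF : Set (PacketAt 𝕜 L α v) → ℝ) : Prop :=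
  Prop39ii_monoAnalyticCompat ((fun e => (MPacketAt.compat e α v).toEquiv) '' P) μD μF

variable {𝕜 D L}

/-- Unfolding of `Prop39ii_atPacket1`: for every member `e ∈ P` and every region `S`,
`μD(S) = μF(MPacket1.compat α (e α) '' S)`. [claim: Mochizuki2012, status: disputed] -/
theorem Prop39ii_atPacket1_iff (α : A) (P : Set (∀ α v, D α v ≃ₗ[𝕜] L α v))
    (μD : Set (MPacket1 D α) → ℝ) (μF : Set (Packet1 L α) → ℝ) :
    Prop39ii_atPacket1 𝕜 D L α P μD μF ↔
      ∀ e ∈ P, ∀ S : Set (MPacket1 D α), μD S = μF (MPacket1.compat α (e α) '' S) := by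
  constructor
  · intro h e he S
    exact h _ ⟨e, he, rfl⟩ S
  · rintro h _ ⟨e, he, rfl⟩ S
    exact h e he S

/-- Unfolding of `Prop39ii_atPacketN`: for every member `e ∈ P` and every region `S`,
`μD(S) = μF(MPacketN.compat e '' S)`. [claim: Mochizuki2012, status: disputed] -/
theorem Prop39ii_atPacketN_iff (P : Set (∀ α v, D α v ≃ₗ[𝕜] L α v))
    (μD : Set (MPacketN 𝕜 D) → ℝ) (μF : Set (PacketN 𝕜 L) → ℝ) :
    Prop39ii_atPacketN 𝕜 D L P μD μF ↔
      ∀ e ∈ P, ∀ S : Set (MPacketN 𝕜 D), μD S = μF (MPacketN.compat e '' S) := by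
  constructor
  · intro h e he S
    exact h _ ⟨MPacketN.compat e, ⟨e, he, rfl⟩, rfl⟩ S
  · rintro h _ ⟨_, ⟨e, he, rfl⟩, rfl⟩ S
    exact h e he S

/-- Unfolding of `Prop39ii_atPacketAt`. [claim: Mochizuki2012, status: disputed] -/
theorem Prop39ii_atPacketAt_iff (α : A) (v : Vfib) (P : Set (∀ α v, D α v ≃ₗ[𝕜] L α v))
    (μD : Set (MPacketAt 𝕜 D α v) → ℝ) (μF : Set (PacketAt 𝕜 L α v) → ℝ) :
    Prop39ii_atPacketAt 𝕜 D L α v P μD μF ↔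
      ∀ e ∈ P, ∀ S : Set (MPacketAt 𝕜 D α v), μD S = μF (MPacketAt.compat e α v '' S) := by
  constructor
  · intro h e he S
    exact h _ ⟨e, he, rfl⟩ S
  · rintro h _ ⟨e, he, rfl⟩ S
    exact h e he S

/-- The packet isomorphism of Prop. 3.2 (i) is computed summand-wise: `(MPacket1.compat α e) x v = e v (x v)`
("functoriality of ⊕"). [claim: Mochizuki2012, status: disputed] -/
theorem MPacket1.compat_apply (α : A) (e : ∀ v, D α v ≃ₗ[𝕜] L α v) (x : MPacket1 D α) (v : Vfib) :
    MPacket1.compat α e x v = e v (x v) := rfl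

/-- The packet isomorphism of Prop. 3.2 (i) maps a direct-product region `∏_v T_v` of the mono-analytic
1-packet onto the direct-product region `∏_v e_v(T_v)` of the holomorphic one (the regions on which
Prop. 3.9 (i)'s packet log-volume is defined). [claim: Mochizuki2012, status: disputed] -/
theorem MPacket1.compat_image_pi (α : A) (e : ∀ v, D α v ≃ₗ[𝕜] L α v) (T : ∀ v, Set (D α v)) :
    MPacket1.compat α e '' Set.pi Set.univ T = Set.pi Set.univ (fun v => e v '' T v) := by
  ext y
  constructor
  · rintro ⟨x, hx, rfl⟩ v -
    exact ⟨x v, hx v (Set.mem_univ _), rfl⟩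
  · intro hy
    refine ⟨fun v => (e v).symm (y v), fun v _ => ?_, ?_⟩
    · obtain ⟨x, hx, hxy⟩ := hy v (Set.mem_univ _)
      show (e v).symm (y v) ∈ T v
      rw [← hxy, LinearEquiv.symm_apply_apply]
      exact hx
    · funext v
      rw [MPacket1.compat_apply, LinearEquiv.apply_symm_apply]

end Junction

/-! ### The 1-packet junction PROVED at the Haar model: products of lattice-respecting summand isomorphisms -/

section PiEquiv

variable {J : Type u₁}
variable {VD : J → Type u₂} [∀ j, AddCommGroup (VD j)] [∀ j, TopologicalSpace (VD j)]
variable {VF : J → Type u₂} [∀ j, AddCommGroup (VF j)] [∀ j, TopologicalSpace (VF j)]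

/-- The product `⊕_v e_v : ⊕_v log(^α𝒟^⊢_v) ⥲ ⊕_v log(^α𝓕_v)` of bicontinuous additive summand isomorphisms, as
a bicontinuous additive isomorphism of the 1-packets (the topological form of `MPacket1.compat`,
Prop. 3.2 (i) "induce natural poly-isomorphisms of ind-topological modules"). [claim: Mochizuki2012, status: disputed] -/
def piSummandsEquiv (e : ∀ j, VD j ≃ₜ+ VF j) : (∀ j, VD j) ≃ₜ+ (∀ j, VF j) :=
  ContinuousAddEquiv.mk' (Homeomorph.piCongrRight fun j => (e j : VD j ≃ₜ VF j))
    (fun x y => funext fun j => map_add (e j) (x j) (y j))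

/-- `piSummandsEquiv e x v = e v (x v)`. [claim: Mochizuki2012, status: disputed] -/
theorem piSummandsEquiv_apply (e : ∀ j, VD j ≃ₜ+ VF j) (x : ∀ j, VD j) (j : J) :
    piSummandsEquiv e x j = e j (x j) := rfl

/-- The product isomorphism maps direct-product regions to direct-product regions:
`(⊕ e_v)(∏_v T_v) = ∏_v e_v(T_v)`. [claim: Mochizuki2012, status: disputed] -/
theorem piSummandsEquiv_image_pi (e : ∀ j, VD j ≃ₜ+ VF j) (T : ∀ j, Set (VD j)) :
    piSummandsEquiv e '' Set.pi Set.univ T = Set.pi Set.univ (fun j => e j '' T j) := by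
  ext y
  constructor
  · rintro ⟨x, hx, rfl⟩ j -
    exact ⟨x j, hx j (Set.mem_univ _), rfl⟩
  · intro hy
    refine ⟨fun j => (e j).symm (y j), fun j _ => ?_, ?_⟩
    · obtain ⟨x, hx, hxy⟩ := hy j (Set.mem_univ _)
      have hx' : (e j).symm (y j) = x :=
        (e j).injective (by rw [ContinuousAddEquiv.apply_symm_apply, hxy])
      show (e j).symm (y j) ∈ T j
      rw [hx']
      exact hx
    · funext j
      rw [piSummandsEquiv_apply, ContinuousAddEquiv.apply_symm_apply]

variable [Fintype J]

/-- If every summand isomorphism carries the mono-analytic integral structure `Λ^D_v` onto the holomorphic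
one `Λ^F_v` ("adjusting appropriately … for the discrepancy between the … integral structures", p. 116),
the product isomorphism carries the product integral structure `∏ Λ^D_v` (campaign-S `IntegralStructure.pi`,
"the integral structures … on each of the direct summand[s]", p. 115) onto `∏ Λ^F_v`.
[claim: Mochizuki2012, status: disputed] -/
theorem piSummandsEquiv_image_pi_integralStructure (e : ∀ j, VD j ≃ₜ+ VF j)
    (ΛD : ∀ j, IntegralStructure (VD j)) (ΛF : ∀ j, IntegralStructure (VF j))
    (h : ∀ j, e j '' (ΛD j : Set (VD j)) = (ΛF j : Set (VF j))) :
    piSummandsEquiv e '' (IntegralStructure.pi ΛD : Set (∀ j, VD j)) =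
      (IntegralStructure.pi ΛF : Set (∀ j, VF j)) := by
  rw [IntegralStructure.coe_pi, IntegralStructure.coe_pi, piSummandsEquiv_image_pi]
  exact Set.pi_congr rfl fun j _ => h j

end PiEquiv

section PiHaar

variable {J : Type u₁} [Fintype J]
variable {VD : J → Type u₂} [∀ j, AddCommGroup (VD j)] [∀ j, TopologicalSpace (VD j)]
  [∀ j, IsTopologicalAddGroup (VD j)] [∀ j, MeasurableSpace (VD j)] [∀ j, BorelSpace (VD j)]
variable {VF : J → Type u₂} [∀ j, AddCommGroup (VF j)] [∀ j, TopologicalSpace (VF j)]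
  [∀ j, IsTopologicalAddGroup (VF j)] [∀ j, MeasurableSpace (VF j)] [∀ j, BorelSpace (VF j)]
variable [∀ j, SecondCountableTopology (VD j)] [∀ j, SecondCountableTopology (VF j)]

/-- **Haar transport along the packet isomorphism**: the `∏ Λ^F_v`-normalised log-volume of the image of ANY
region `S ⊆ ⊕_v log(^α𝒟^⊢_v)` equals its `∏ Λ^D_v`-normalised log-volume ([AbsTopIII] Prop. 5.7 (i): uniqueness
of the normalised Haar measure; campaign-S `IntegralStructure.logVolume_image_equiv`).
[claim: Mochizuki2012, status: disputed] -/
theorem pi_logVolume_image_piSummandsEquiv (e : ∀ j, VD j ≃ₜ+ VF j)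
    (ΛD : ∀ j, IntegralStructure (VD j)) (ΛF : ∀ j, IntegralStructure (VF j))
    (h : ∀ j, e j '' (ΛD j : Set (VD j)) = (ΛF j : Set (VF j))) (S : Set (∀ j, VD j)) :
    (IntegralStructure.pi ΛF).logVolume (piSummandsEquiv e '' S) =
      (IntegralStructure.pi ΛD).logVolume S :=
  (IntegralStructure.pi ΛD).logVolume_image_equiv (IntegralStructure.pi ΛF) (piSummandsEquiv e)
    (piSummandsEquiv_image_pi_integralStructure e ΛD ΛF h) S

/-- **[IUTchIII] Prop. 3.9 (ii) at the 1-packet level, ALL regions — PROVED at the Haar model.** For a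
poly-isomorphism `poly` whose members are families of bicontinuous additive summand isomorphisms carrying
`Λ^D_v` onto `Λ^F_v`, abc-iut-L6-t4's `Prop39ii_monoAnalyticCompat` HOLDS for the induced poly-isomorphism of
1-packets (the shape `MPacket1.compat` of Prop. 3.2 (i)), the mono-analytic side carrying the `∏ Λ^D_v`-, the
holomorphic side the `∏ Λ^F_v`-normalised product Haar log-volume (campaign-S `IntegralStructure.pi`;
unweighted, cf. Rmk. 3.1.1 (iii)). [claim: Mochizuki2012, status: disputed] -/
theorem prop39ii_monoAnalyticCompat_piSummands (ΛD : ∀ j, IntegralStructure (VD j))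
    (ΛF : ∀ j, IntegralStructure (VF j)) (poly : Set (∀ j, VD j ≃ₜ+ VF j))
    (h : ∀ e ∈ poly, ∀ j, e j '' (ΛD j : Set (VD j)) = (ΛF j : Set (VF j))) :
    Prop39ii_monoAnalyticCompat ((fun e => (piSummandsEquiv e).toEquiv) '' poly)
      (IntegralStructure.pi ΛD).logVolume (IntegralStructure.pi ΛF).logVolume := by
  rintro _ ⟨e, he, rfl⟩ S
  have hS : ((piSummandsEquiv e).toEquiv : (∀ j, VD j) → ∀ j, VF j) '' S = piSummandsEquiv e '' S := rfl
  rw [hS, pi_logVolume_image_piSummandsEquiv e ΛD ΛF (h e he) S]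

end PiHaar

section PiWeighted

variable {J : Type u₁} [Fintype J]
variable {VD : J → Type u₂} [∀ j, AddCommGroup (VD j)] [∀ j, TopologicalSpace (VD j)]
  [∀ j, IsTopologicalAddGroup (VD j)] [∀ j, MeasurableSpace (VD j)] [∀ j, BorelSpace (VD j)]
variable {VF : J → Type u₂} [∀ j, AddCommGroup (VF j)] [∀ j, TopologicalSpace (VF j)]
  [∀ j, IsTopologicalAddGroup (VF j)] [∀ j, MeasurableSpace (VF j)] [∀ j, BorelSpace (VF j)]

/-- **[IUTchIII] Prop. 3.9 (ii) for the PRINTED packet-normalised log-volume of (i)** (weights `w_v` of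
Rmk. 3.1.1 (ii); direct-product regions `∏_v T_v`, the "`𝕄(−)`" on which abc-iut-L6-t4's `packetLogVolume` is
defined): along a family of lattice-respecting bicontinuous additive summand isomorphisms the packet log-volume
is unchanged — `Σ_v w_v·μ^log_{Λ^F_v}(e_v(T_v)) = Σ_v w_v·μ^log_{Λ^D_v}(T_v)`, whatever the weights.
[claim: Mochizuki2012, status: disputed] -/
theorem packetLogVolume_image_piSummands (ΛD : ∀ j, IntegralStructure (VD j))
    (ΛF : ∀ j, IntegralStructure (VF j)) (w : J → ℝ) (e : ∀ j, VD j ≃ₜ+ VF j)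
    (h : ∀ j, e j '' (ΛD j : Set (VD j)) = (ΛF j : Set (VF j))) (T : ∀ j, Set (VD j)) :
    packetLogVolume w (fun j => (ΛF j).haar) (fun j => e j '' T j) =
      packetLogVolume w (fun j => (ΛD j).haar) T := by
  unfold packetLogVolume
  refine Finset.sum_congr rfl fun j _ => ?_
  have hj := (ΛD j).logVolume_image_equiv (ΛF j) (e j) (h j) (T j)
  simp only [IntegralStructure.logVolume] at hj
  rw [hj]

end PiWeighted

/-! ### Tying the two shapes: `MPacket1.compat` IS the product isomorphism on underlying functions -/

section Tie

variable {𝕜 : Type u} [Field 𝕜]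
variable {A : Type v} {Vfib : Type v'}
variable {D : A → Vfib → Type w} [∀ α v, AddCommGroup (D α v)] [∀ α v, Module 𝕜 (D α v)]
  [∀ α v, TopologicalSpace (D α v)]
variable {L : A → Vfib → Type w} [∀ α v, CommRing (L α v)] [∀ α v, Algebra 𝕜 (L α v)]
  [∀ α v, TopologicalSpace (L α v)]

/-- If the summand isomorphisms `e_v` of Prop. 3.2 (i) are (the linear maps underlying) bicontinuous additive
isomorphisms `ẽ_v`, then abc-iut-L6-t4's packet isomorphism `MPacket1.compat α e` and the product isomorphism
`piSummandsEquiv ẽ` are the same map of 1-packets — so `prop39ii_monoAnalyticCompat_piSummands` /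
`packetLogVolume_image_piSummands` ARE statements about the poly-isomorphism of Prop. 3.2 (i).
[claim: Mochizuki2012, status: disputed] -/
theorem coe_MPacket1_compat (α : A) (e : ∀ v, D α v ≃ₗ[𝕜] L α v) (e' : ∀ v, D α v ≃ₜ+ L α v)
    (he : ∀ v x, e v x = e' v x) :
    (MPacket1.compat α e : MPacket1 D α → Packet1 L α) = piSummandsEquiv e' := by
  funext x
  funext v
  rw [MPacket1.compat_apply, piSummandsEquiv_apply, he]

/-- Consequently the two induced poly-isomorphisms of 1-packets have the same members as bijections, and
`Prop39ii_atPacket1` for `P` is `Prop39ii_monoAnalyticCompat` for the product poly-isomorphism.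
[claim: Mochizuki2012, status: disputed] -/
theorem Prop39ii_atPacket1_of_piSummands (α : A) (P : Set (∀ α v, D α v ≃ₗ[𝕜] L α v))
    (lift : ∀ e ∈ P, ∀ v, D α v ≃ₜ+ L α v) (hlift : ∀ e (he : e ∈ P) v x, e α v x = lift e he v x)
    (μD : Set (MPacket1 D α) → ℝ) (μF : Set (Packet1 L α) → ℝ)
    (h : ∀ e (he : e ∈ P) (S : Set (MPacket1 D α)), μD S = μF (piSummandsEquiv (lift e he) '' S)) :
    Prop39ii_atPacket1 𝕜 D L α P μD μF := by
  rw [Prop39ii_atPacket1_iff]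
  intro e he S
  rw [coe_MPacket1_compat α (e α) (lift e he) (hlift e he)]
  exact h e he S

end Tie

end Literature.IUT.LogThetaLattice

end
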